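import Summits.RiemannHypothesis.RiemannHypothesis.Theorems.WeilGroundStateArchimedeanWindowSimpleEvenGapDefs
import HarnessLib

/-!
# `ArchimedeanWindowSimpleEven` — kernel check of the first half of the moment table (`q ≤ N`)

`checkNuA_weilGapCert`: the table check `checkNuA` of the gap checker `WeilGapCert.checkG` passes on
the data `weilGapCert`, evaluated by `decide +kernel` in two quarters (`allB 8 0 44 = allB 7 0 22 &&
allB 7 22 22` definitionally; each quarter is about a minute of kernel time).

Route `RiemannHypothesis/WeilGroundState`, item `ArchimedeanWindowSimpleEven` (stmt-RiemannHypothesis-1529).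
See `WeilGroundStateArchimedeanWindowSimpleEvenGapDefs.lean` for the certificate format, the data and the
overall plan.
-/

namespace Summit.RiemannHypothesis.RiemannHypothesis.Theorems.WeilGroundState

open Literature.NumberTheory.LFunctions

set_option maxHeartbeats 0 in
/-- **Kernel check** of the table entries `q < 22`. [folklore] -/
theorem checkNuA1_weilGapCert : WeilGapCert.allB 7 0 22 weilGapCert.nuP = true := by
  decide +kernel

set_option maxHeartbeats 0 in
/-- **Kernel check** of the table entries `22 ≤ q < 44`. [folklore] -/
theorem checkNuA2_weilGapCert : WeilGapCert.allB 7 22 22 weilGapCert.nuP = true := by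
  decide +kernel

/-- **Kernel check**: `weilGapCert.checkNuA = true`. [folklore] -/
theorem checkNuA_weilGapCert : weilGapCert.checkNuA = true := by
  have e : weilGapCert.checkNuA =
      (WeilGapCert.allB 7 0 22 weilGapCert.nuP && WeilGapCert.allB 7 22 22 weilGapCert.nuP) := rfl
  rw [e, checkNuA1_weilGapCert, checkNuA2_weilGapCert]
  rfl

end Summit.RiemannHypothesis.RiemannHypothesis.Theorems.WeilGroundState
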